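import Summits.HodgeConjecture.HodgeConjecture.Theorems.K2E1bU21HighestWeightSpaces   -- ★ E1b αᵤ-1: `wtSpace`, `hwSpace`, `labelN`, `labelM`, `labelE` (Kovačević's `K`-type labels `(n, m, e)`)
import Summits.HodgeConjecture.HodgeConjecture.Theorems.K2E1bDSClsOfRecord            -- ★ E1b U8-4: `dsClsOfRecord`, `dsCellDatum`; brings ★ #23 `K2E1bCarriersOfRecord` (`jInfOfRecord`, `dsInfOfRecord`, `jDatumOfRecord`, `dsDatumOfRecord`, packages), ★ leaf `casimirExp`∕`centralExp`∕`HasChiScalars`, ★ `IsCohUnitaryIrrep`, ★ U8 `IsRegularParam`∕`casimirOf`∕`centralOf`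
import HarnessLib

/-!
# R90-TF ∕ S2 «Ch11-arch» — ★ DEFINITIONS `R90S2RecognitionOfRecordDefs`: the RECOGNITION STATEMENTS OF RECORD (Level-B dictionary, in-house half)

Cell `pub/hodgecm-mathlib`, HCML Track R90-TF, section S2 (base `R90-C11`), typist `R90-C11-typ1` (g2); crux h413 = `stmt-HodgeConjecture-24833`, route of record
`HCCMUnconditional`.  DEAL: S2 dealer K2E1b-plan (g7) RULING E4-Q4 (β) 2026-09-04T16:24:42Z «S-LAYER PROVER HAND RecognitionOfRecord (not a socket, not floor):
typ1 TYPES the three statement bytes `recognition_jInfOfRecord ∕ _dsInfOfRecord ∕ _dsClsOfRecord` over ★ `hwSpace`∕`labelN∕labelM∕labelE`∕`HasChiScalars`∕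
`IsCohUnitaryIrrep` as `def …Stmt : Prop` + docstring in a ★-cand Theorems file; a K2E1b∕E4 prover pays `…Stmt`-holds from ★ `modelOfRecordCohUnitary` + ★
`K2E1bDSRecordRecognition` when free (cells S, strips M)».  AUDIT PRE-FLAG R90-C11-audit1 (g0) 16:17:42Z folded: F-1 «χ-scalars ≠ infinitesimal character» — the
hypothesis is NOT the χ-scalars alone but the χ-scalars AND the FULL `K`-type support (so the LOWEST `K`-type = Kovačević's vertex is part of the data; vertex +
quadratic Casimir + central label pin the datum's `K`-types and invariant products: ★ `mem_iff_and_products_eq_of_vertex_of_casimir`); F-2 «contains ≠ lowest» —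
support is an EQUALITY of sets, not a membership.  Proposed VERBATIM by the S2 prover pen (`--kind definition --supports stmt-HodgeConjecture-24833`); this file
closes nothing and is NOT a socket: nothing in `Cruxes/…/Lines` waits on it (E4-Q4 (α): floor (E4) = label-only).

## PRINT ∕ DICTIONARY [Rogawski1990, §12.3 pp. 176–178; BorelWallach2000, VI 4.10–4.12; Kovacevic2021, §3 Def. 1, Thm. 1–3, Remark 3]

Print's archimedean table (p. 178): `Π(ξ) = {πⁿ(ξ), πˢ(ξ)}` with `πⁿ(ξ) = J^±_φ` (Langlands quotient of `i_G(χ^±_φ)`) and `πˢ(ξ) = D^∓_φ ∕ π²_φ`; the tree's LEVEL-A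
carriers are the Kovačević data of record (★ `jDatumOfRecord`, ★ `dsDatumOfRecord`, ★ `dsCellDatum j a b c`) bundled as `(𝔲(2,1), K)`-modules with classes ★
`jInfOfRecord p q t`, ★ `dsInfOfRecord p q t`, ★ `dsClsOfRecord a b c j`.  The LEVEL-B dictionary has two halves (S2 REPORT v2 16:24:26Z): RECOGNITION — «an irreducible
coh-unitary `(𝔲(2,1), K)`-module with the χ-scalars and the `K`-types of a carrier of record IS that carrier (same class)» — typable and ★-reachable in-house, THIS
FILE states it; ATTRIBUTION — «print's `J^±_φ`, `D_φ`, … have these χ-scalars and `K`-types» — no ★ currency today (no principal series ∕ Langlands quotient ∕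
Harish-Chandra parameter for `U(2,1)_∞` in the tree), carried as the R-H3 label (hole D-S2-5).

## WHAT IS DEFINED (★ currency only)

* `kTypeSupport ρ𝔤 e : Set (ℤ × ℤ)` — the `K`-TYPE SUPPORT of a `(𝔤, K)`-module of `U(2,1)` at central label `e`, in Kovačević's labels: `(n, m)` belongs iff some
  torus weight `w` with `(labelN w, labelM w, labelE w) = (n, m, e)` has a nonzero `𝔨`-highest line ★ `hwSpace ρ𝔤 w ≠ ⊥` (★ `eq_of_labels_eq`: the labels determine
  `w`).  This is the currency of ★ `exists_datum` (clauses (i)–(ii): `(n, m) ∈ 𝒟.S ↔ u n m ≠ 0`, `u n m ∈ hwSpace ρ𝔤 w`).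
* `RecognitionJInfOfRecordStmt`, `RecognitionDsInfOfRecordStmt` (strips, every `(p, q, t)`), `RecognitionDsClsOfRecordStmt` (cells, regular `(a, b, c)`, `j : Fin 3`)
  — `def … : Prop` WITH BODY (DEFS BEFORE SIGS), each: for every bundled irreducible `(𝔤, K)`-module `r : GKIrrep G21` that is coh-unitary (★ `IsCohUnitaryIrrep`), has
  the χ-scalars of record (★ `HasChiScalars r.ρ𝔤 κ e` with `(κ, e) = (casimirExp, centralExp) p q t` ∕ `(casimirOf, centralOf) a b c`) and has EXACTLY the `K`-type
  support of the datum of record (`kTypeSupport r.ρ𝔤 e = 𝒟.S`), the class is the class of record.  Read-backs `…Stmt_iff` (`Iff.rfl`) fix the unfolding.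

PAYMENT ROAD (for the prover; informational): ★ `modelOfRecordCohUnitary` (`r ↦` a Kovačević datum `𝒟'` with `GKIrrClass.mk r = mk ⟨𝒟'.V, …⟩`); transport of
`kTypeSupport` along the `(𝔤, K)`-equivalence and ★ `exists_datum` (ii) ⇒ `𝒟'.S = 𝒟.S`; the common vertex + ★ `casimirScalar_eq_of_hasChiScalars` ⇒ products
(★ `mem_iff_and_products_eq_of_vertex_of_casimir`, ★ `exists_lower_of_ne`, ★ `forall_reach_of_isIrreducible`); ★ `areGKEquivalent_ofRecord_of_products_eq` ∕ ★
`mk_ofRecord_eq_dsClsOfRecord` ⇒ the class.  Why it might fail as typed: a ray datum of record without an `n = 1` `K`-type would starve the Casimir read-off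
(★ `casimirScalar_eq_of_hasChiScalars` is stated on the line `n = 1`) — the wall rays have `n₀ = 1`; the `J`-ladder rays start at `n₀ = −s ∕ s + 1 ≥ 1`, where the
vertex relations must be read directly (Kovačević Thm. 1 at the vertex); if that read-off is not in the tree yet it is prover work, not a change of statement.

NOT here: any theorem with content, any socket, any instance declaration (one `attribute [local instance]` = the Mathlib∕tree idiom of every `(𝔤, K)` file),
no notation, no `sorry`.  HONEST LABEL: definitions close nothing; HC_CM is proved only modulo the 7 printed citations (2 remaining named inputs: hLiu418 =
stmt-HodgeConjecture-24832, h413 = stmt-HodgeConjecture-24833) until rung 0 closes.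
-/

set_option autoImplicit false
set_option linter.dupNamespace false

noncomputable section

open Literature.NumberTheory.Automorphic
open Literature.RepresentationTheory
open Literature.RepresentationTheory.KonnoKonno2007 Literature.RepresentationTheory.KonnoKonno2007.RealDualPair
open Literature.RepresentationTheory.KonnoKonno2007.RealDualPair.UForm
open Literature.RepresentationTheory.Kovacevic2021
open Summit.HodgeConjecture.HodgeConjecture.Cruxes.H413.F0P3bLocalAPacketsDefs (G21)
open Summit.HodgeConjecture.HodgeConjecture.Cruxes.H413.F0P3bArchDegOnePackage (IsCohUnitaryIrrep)
open Summit.HodgeConjecture.HodgeConjecture.Cruxes.H413.K2E1bGKCohomologyU21 (centralExp casimirExp HasChiScalars)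
open Summit.HodgeConjecture.HodgeConjecture.Cruxes.H413.K2E1bGKCohomologyU21.U8 (IsRegularParam casimirOf centralOf)
open Summit.HodgeConjecture.HodgeConjecture.Cruxes.H413.K2E1bU21Weights (hwSpace labelN labelM labelE)
open Summit.HodgeConjecture.HodgeConjecture.Cruxes.H413.K2E1bCarriersOfRecord (jInfOfRecord dsInfOfRecord jDatumOfRecord dsDatumOfRecord)
open Summit.HodgeConjecture.HodgeConjecture.Cruxes.H413.K2E1bDSCellData (dsCellDatum)
open Summit.HodgeConjecture.HodgeConjecture.Cruxes.H413.K2E1bDSClsOfRecord (dsClsOfRecord)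

namespace Summit.HodgeConjecture.HodgeConjecture.R90.S2

-- Mathlib∕tree idiom (as in ★ `GKModules`, ★ `K2E1bGKCohomologyU21Defs`, every Kovačević file): the commutator bracket on `Module.End ℂ V`, needed to MENTION
-- `ρ𝔤 : G21.lie →ₗ⁅ℝ⁆ Module.End ℂ V`.
attribute [local instance 100] LieRing.ofAssociativeRing

/-! ## §1 The `K`-type support of a `(𝔤, K)`-module of `U(2,1)` in Kovačević's labels [Kovacevic2021, §3 Def. 1] -/

/-- **`K`-TYPE SUPPORT at central label `e`**: the set of labels `(n, m)` such that some torus weight `w` with `labelN w = n`, `labelM w = m`, `labelE w = e` carries a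
nonzero `𝔨`-highest line (★ `hwSpace ρ𝔤 w ≠ ⊥`) — i.e. the `K`-type `V_{n,m}` (at central weight `e`) OCCURS in the module.  The currency of ★ `exists_datum` (ii).
(print: Kovacevic2021, §3 Def. 1; BorelWallach2000, 0 §2.5) — a route-posited definition of the engine line (hence untagged). -/
def kTypeSupport {V : Type} [AddCommGroup V] [Module ℂ V] (ρ𝔤 : G21.lie →ₗ⁅ℝ⁆ Module.End ℂ V) (e : ℤ) : Set (ℤ × ℤ) :=
  {nm | ∃ w : Fin 2 ⊕ Fin 1 → ℤ, labelN w = nm.1 ∧ labelM w = nm.2 ∧ labelE w = e ∧ hwSpace ρ𝔤 w ≠ ⊥}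

/-- Membership in the `K`-type support (definitional). [cite: Kovacevic2021, §3 Def. 1] -/
theorem mem_kTypeSupport_iff {V : Type} [AddCommGroup V] [Module ℂ V] (ρ𝔤 : G21.lie →ₗ⁅ℝ⁆ Module.End ℂ V) (e : ℤ) (n m : ℤ) :
    (n, m) ∈ kTypeSupport ρ𝔤 e ↔ ∃ w : Fin 2 ⊕ Fin 1 → ℤ, labelN w = n ∧ labelM w = m ∧ labelE w = e ∧ hwSpace ρ𝔤 w ≠ ⊥ :=
  Iff.rfl

/-! ## §2 The three recognition statements of record (DEFS BEFORE SIGS: `def … : Prop` with body; paid by a ★ theorem of exactly this type)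
[Rogawski1990, §12.3 pp. 176–178; Kovacevic2021, §3 Thm. 2, Remark 3] -/

/-- **RECOGNITION OF `jInfOfRecord` (strips; every `(p, q, t)`)**: an irreducible coh-unitary `(𝔲(2,1), K)`-module (★ `IsCohUnitaryIrrep`) with the χ-scalars of record
`(casimirExp p q t, centralExp p q t)` (★ `HasChiScalars`) and EXACTLY the `K`-types of the `J`-datum of record (★ `jDatumOfRecord (p + t)`: the ladder ray of
`J^±_φ`, `φ = rogTriple p q t`) has the class ★ `jInfOfRecord p q t`.  In-house half of the Level-B dictionary for `πⁿ(ξ)`; the representative ★ `jRepOfRecord p q t`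
itself has the first two hypotheses (★ `jRepOfRecord_package`) and its support is `(jDatumOfRecord (p + t)).S` by construction (the prover's first lemma:
`hwSpace` of a structure of record ★ `σOfRecord 𝒟 e` is spanned by Kovačević's `u¹_{n,m}`, `(n, m) ∈ 𝒟.S`), so the statement is not vacuous.
(print: Rogawski1990, §12.3 p. 178; Kovacevic2021, §3 Thm. 2–3, Remark 3; §4 Thm. 4–5) — a route-posited statement of the engine line (hence untagged). -/
def RecognitionJInfOfRecordStmt : Prop :=
  ∀ (p q t : ℤ) (r : GKIrrep G21), IsCohUnitaryIrrep r.ρK r.ρ𝔤 → HasChiScalars r.ρ𝔤 (casimirExp p q t) (centralExp p q t) →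
    kTypeSupport r.ρ𝔤 (centralExp p q t) = (jDatumOfRecord (p + t)).S → GKIrrClass.mk r = jInfOfRecord p q t

/-- **RECOGNITION OF `dsInfOfRecord` (strips; every `(p, q, t)`)**: an irreducible coh-unitary `(𝔲(2,1), K)`-module with the χ-scalars of record
`(casimirExp p q t, centralExp p q t)` and EXACTLY the `K`-types of the square-integrable datum of record (★ `dsDatumOfRecord (p + t)`: the wall ray, `n₀ = 1`;
on the locus `D₀ ∕ D₂`) has the class ★ `dsInfOfRecord p q t`.  In-house half of the Level-B dictionary for `πˢ(ξ)`; witnessed by ★ `dsRepOfRecord p q t`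
(★ `dsRepOfRecord_package`; support by the same first lemma). (print: Rogawski1990, §12.3 pp. 177–178; Kovacevic2021, §3 Thm. 2–3, Remark 3; §4 Thm. 4–5; BorelWallach2000, VI 4.10)
— a route-posited statement of the engine line (hence untagged). -/
def RecognitionDsInfOfRecordStmt : Prop :=
  ∀ (p q t : ℤ) (r : GKIrrep G21), IsCohUnitaryIrrep r.ρK r.ρ𝔤 → HasChiScalars r.ρ𝔤 (casimirExp p q t) (centralExp p q t) →
    kTypeSupport r.ρ𝔤 (centralExp p q t) = (dsDatumOfRecord (p + t)).S → GKIrrClass.mk r = dsInfOfRecord p q t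

/-- **RECOGNITION OF `dsClsOfRecord` (cells; regular `(a, b, c)`, `j : Fin 3`)**: at a regular parameter (★ `IsRegularParam a b c`), an irreducible coh-unitary
`(𝔲(2,1), K)`-module with the χ-scalars `(casimirOf a b c, centralOf a b c)` and EXACTLY the `K`-types of the record cell ★ `dsCellDatum j a b c` (`D_φ, D⁺_φ, D⁻_φ`)
has the class ★ `dsClsOfRecord a b c j`.  The abstract-module form of ★ `mk_ofRecord_eq_dsClsOfRecord` (whose datum-level hypotheses `hS hP hQ` follow from the
support equality and the χ-scalars: ★ `mem_iff_and_products_eq_of_vertex_of_casimir`).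
(print: Rogawski1990, §12.3 pp. 176–178; Kovacevic2021, §3 Thm. 2–3, Remark 3; BorelWallach2000, VI 4.10–4.12) — a route-posited statement of the engine line
(hence untagged). -/
def RecognitionDsClsOfRecordStmt : Prop :=
  ∀ (a b c : ℤ), IsRegularParam a b c → ∀ (j : Fin 3) (r : GKIrrep G21), IsCohUnitaryIrrep r.ρK r.ρ𝔤 →
    HasChiScalars r.ρ𝔤 (casimirOf a b c) (centralOf a b c) →
    kTypeSupport r.ρ𝔤 (centralOf a b c) = (dsCellDatum j a b c).S → GKIrrClass.mk r = dsClsOfRecord a b c j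

/-! ## §3 Read-backs (definitional unfoldings, `Iff.rfl`) -/

/-- Unfolding of `RecognitionJInfOfRecordStmt`. [cite: Rogawski1990, §12.3 p. 178] -/
theorem recognitionJInfOfRecordStmt_iff : RecognitionJInfOfRecordStmt ↔
    ∀ (p q t : ℤ) (r : GKIrrep G21), IsCohUnitaryIrrep r.ρK r.ρ𝔤 → HasChiScalars r.ρ𝔤 (casimirExp p q t) (centralExp p q t) →
      kTypeSupport r.ρ𝔤 (centralExp p q t) = (jDatumOfRecord (p + t)).S → GKIrrClass.mk r = jInfOfRecord p q t :=
  Iff.rfl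

/-- Unfolding of `RecognitionDsInfOfRecordStmt`. [cite: Rogawski1990, §12.3 pp. 177–178] -/
theorem recognitionDsInfOfRecordStmt_iff : RecognitionDsInfOfRecordStmt ↔
    ∀ (p q t : ℤ) (r : GKIrrep G21), IsCohUnitaryIrrep r.ρK r.ρ𝔤 → HasChiScalars r.ρ𝔤 (casimirExp p q t) (centralExp p q t) →
      kTypeSupport r.ρ𝔤 (centralExp p q t) = (dsDatumOfRecord (p + t)).S → GKIrrClass.mk r = dsInfOfRecord p q t :=
  Iff.rfl

/-- Unfolding of `RecognitionDsClsOfRecordStmt`. [cite: Rogawski1990, §12.3 pp. 176–178] -/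
theorem recognitionDsClsOfRecordStmt_iff : RecognitionDsClsOfRecordStmt ↔
    ∀ (a b c : ℤ), IsRegularParam a b c → ∀ (j : Fin 3) (r : GKIrrep G21), IsCohUnitaryIrrep r.ρK r.ρ𝔤 →
      HasChiScalars r.ρ𝔤 (casimirOf a b c) (centralOf a b c) →
      kTypeSupport r.ρ𝔤 (centralOf a b c) = (dsCellDatum j a b c).S → GKIrrClass.mk r = dsClsOfRecord a b c j :=
  Iff.rfl

end Summit.HodgeConjecture.HodgeConjecture.R90.S2

end
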